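import Mathlib
import Summits.Ventures.PercRepro2.EdgeCubic
import Summits.Ventures.PercRepro2.MixChordWeakest
import Summits.Ventures.PercRepro2.MixChordOLeafRoot

/-!
# The `D·Z`-chord along an `o`-class root edge IS the pair `A ≥ 0 ∧ B ≥ 0` of its Bernstein slopes
(blind cell PercRepro2, night-1 g28; proofs/NIGHT1-G28.md §1)

Along any edge `e` (`q = p e`) p5's one-edge cubic (`EdgeLine.Gc_pin_cubic`) reads
`Gc p = (1 − q)³ Gc p⁰ + q(1 − q)² B1 + q²(1 − q) B2 + q³ Gc p¹` with the Bernstein coefficients `B1`, `B2`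
(`EdgeLine.B1`, `EdgeLine.B2`: the cubic form of `Gc` polarised between the closed child `p⁰ = p[e ↦ 0]` and the
open child `p¹ = p[e ↦ 1]`).  Along an edge whose open child has `Gc p¹ = 0` — every `o`-class root edge
(`ParallelEdge.Gc_update_one_eq_zero_of_oClass`) — the cleared `D·Z`-chord deficit is EXACTLY

  `(Gc p − q Gc p¹) · D⁰Z⁰ − (1 − q) Gc p⁰ · D(p)Z(p) = q (1 − q) [(1 − q) · A + q · B]`,

  `A = B1 · D⁰Z⁰ − Gc p⁰ · (D⁰Z¹ + D¹Z⁰)`,  `B = B2 · D⁰Z⁰ − Gc p⁰ · D¹Z¹`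

(**`dzChord_deficit_eq`**, from the ring identity `dzChord_bern_identity` in eight numbers).  Hence:

* **`nMixChord_DZ_of_bern`**: `A ≥ 0 → B ≥ 0 →` the `D·Z`-chord along `e`, at ANY weight `q ∈ [0, 1]`;
  **`nMixChord_DZ2_of_bern`**: with `Gc p⁰ ≥ 0` the chain's `(D·Z)²`-chord (g22's weakening);
* **`chordAB_nonneg_of_nMixChord_all`**: CONVERSELY, the `D·Z`-chord along `e` at every weight of `e` forces
  `A ≥ 0` and `B ≥ 0` (`A` is the `q → 0` slope, `B` the `q → 1` slope of the deficit; `nonneg_left_of_slopes`)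
  — so the row `DZChordO_all` is exactly the pair of `q`-FREE polynomial inequalities `A ≥ 0 ∧ B ≥ 0` in the
  twelve atoms of the two children of every `o`-class root edge;
* the `o`-class wrappers **`nMixChord_DZ_of_oClass_bern`** / **`nMixChord_DZ2_of_oClass_bern`**.

The atoms of `p¹` are readings of `p⁰`-events (`o` joins `C₁` and its cluster outside `U` with it), so `A`, `B`
are polynomials in the refined cells of `p⁰` alone; NIGHT1-G28.md §2 carries their certificates on the separated,
`o`-pin and `a₃`-isolated classes in that form, and the census of what a general certificate needs.

Own code; standard axioms.
-/

namespace Summit.Ventures.PercRepro2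

open UnionCluster CovForm

namespace Mix

section Identity

variable {R : Type*} [Field R]

/-- **The cleared `D·Z`-chord deficit along an edge with `Gc p¹ = 0`** in the eight numbers `G⁰ = Gc p⁰`,
`B1`, `B2`, `D⁰`, `D¹`, `Z⁰`, `Z¹`, `q`: `q (1 − q) [(1 − q) A + q B]`. -/
lemma dzChord_bern_identity (G0 B1 B2 D0 D1 Z0 Z1 q : R) :
    ((1 - q) ^ 3 * G0 + q * (1 - q) ^ 2 * B1 + q ^ 2 * (1 - q) * B2) * (D0 * Z0) -
        (1 - q) * G0 * (((1 - q) * D0 + q * D1) * ((1 - q) * Z0 + q * Z1)) =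
      q * (1 - q) * ((1 - q) * (B1 * (D0 * Z0) - G0 * (D0 * Z1 + D1 * Z0)) +
        q * (B2 * (D0 * Z0) - G0 * (D1 * Z1))) := by
  ring

end Identity

section Chord

variable {V : Type*} {E : Type*} [Fintype E] [DecidableEq E] {R : Type*} [Field R] [LinearOrder R]
  [IsStrictOrderedRing R]

variable (p : E → R) (ends : E → Sym2 V) (o a₁ a₂ a₃ b : V) (e : E)

/-- **`A`**: the `q → 0` slope of the cleared `D·Z`-chord deficit along `e`:
`B1 · D⁰Z⁰ − Gc p⁰ · (D⁰Z¹ + D¹Z⁰)`. -/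
noncomputable def chordA : R :=
  EdgeLine.B1 p ends o a₁ a₂ a₃ b e *
      (prob (Function.update p e 0) (PDEvent ends a₁ a₂ a₃) * prob (Function.update p e 0) (avoidAll ends a₂ {a₁})) -
    Gc (Function.update p e 0) ends o a₁ a₂ a₃ b *
      (prob (Function.update p e 0) (PDEvent ends a₁ a₂ a₃) * prob (Function.update p e 1) (avoidAll ends a₂ {a₁}) +
        prob (Function.update p e 1) (PDEvent ends a₁ a₂ a₃) * prob (Function.update p e 0) (avoidAll ends a₂ {a₁}))

/-- **`B`**: the `q → 1` slope of the cleared `D·Z`-chord deficit along `e`: `B2 · D⁰Z⁰ − Gc p⁰ · D¹Z¹`. -/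
noncomputable def chordB : R :=
  EdgeLine.B2 p ends o a₁ a₂ a₃ b e *
      (prob (Function.update p e 0) (PDEvent ends a₁ a₂ a₃) * prob (Function.update p e 0) (avoidAll ends a₂ {a₁})) -
    Gc (Function.update p e 0) ends o a₁ a₂ a₃ b *
      (prob (Function.update p e 1) (PDEvent ends a₁ a₂ a₃) * prob (Function.update p e 1) (avoidAll ends a₂ {a₁}))

omit [LinearOrder R] [IsStrictOrderedRing R] in
/-- The pin of a probability, `(1 − q)`-first. -/
lemma prob_pin_closed_first (A : Set (Config E)) :
    prob p A = (1 - p e) * prob (Function.update p e 0) A + p e * prob (Function.update p e 1) A := by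
  rw [prob_eq_pin p A e]
  ring

/-- **The cleared `D·Z`-chord deficit along an edge with `Gc p¹ = 0`** is `q (1 − q) [(1 − q) A + q B]`. -/
theorem dzChord_deficit_eq (h1 : Gc (Function.update p e 1) ends o a₁ a₂ a₃ b = 0) :
    (Gc p ends o a₁ a₂ a₃ b - p e * Gc (Function.update p e 1) ends o a₁ a₂ a₃ b) *
        normDZ ends a₁ a₂ a₃ (Function.update p e 0) -
      (1 - p e) * Gc (Function.update p e 0) ends o a₁ a₂ a₃ b * normDZ ends a₁ a₂ a₃ p =
    p e * (1 - p e) * ((1 - p e) * chordA p ends o a₁ a₂ a₃ b e + p e * chordB p ends o a₁ a₂ a₃ b e) := by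
  have hpin := EdgeLine.Gc_pin_cubic p ends o a₁ a₂ a₃ b e
  rw [h1] at hpin
  unfold normDZ chordA chordB
  rw [hpin, h1, prob_pin_closed_first p e (avoidAll ends a₂ {a₁}), prob_pin_closed_first p e (PDEvent ends a₁ a₂ a₃)]
  have key := dzChord_bern_identity (Gc (Function.update p e 0) ends o a₁ a₂ a₃ b)
    (EdgeLine.B1 p ends o a₁ a₂ a₃ b e) (EdgeLine.B2 p ends o a₁ a₂ a₃ b e)
    (prob (Function.update p e 0) (PDEvent ends a₁ a₂ a₃)) (prob (Function.update p e 1) (PDEvent ends a₁ a₂ a₃))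
    (prob (Function.update p e 0) (avoidAll ends a₂ {a₁})) (prob (Function.update p e 1) (avoidAll ends a₂ {a₁})) (p e)
  linear_combination key

variable {p ends o a₁ a₂ a₃ b e}

/-- **The `D·Z`-chord along an edge whose open child has `Gc = 0` from `A ≥ 0` and `B ≥ 0`.** -/
theorem nMixChord_DZ_of_bern (hp : IsProbVec p) (h1 : Gc (Function.update p e 1) ends o a₁ a₂ a₃ b = 0)
    (hA : 0 ≤ chordA p ends o a₁ a₂ a₃ b e) (hB : 0 ≤ chordB p ends o a₁ a₂ a₃ b e) :
    NMixChord (normDZ ends a₁ a₂ a₃) p ends o a₁ a₂ a₃ b e := by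
  have hq0 := hp.nonneg e
  have hq1 : 0 ≤ 1 - p e := sub_nonneg.2 (hp.le_one e)
  have hdef := dzChord_deficit_eq p ends o a₁ a₂ a₃ b e h1
  have hnn : 0 ≤ p e * (1 - p e) * ((1 - p e) * chordA p ends o a₁ a₂ a₃ b e + p e * chordB p ends o a₁ a₂ a₃ b e) :=
    mul_nonneg (mul_nonneg hq0 hq1) (add_nonneg (mul_nonneg hq1 hA) (mul_nonneg hq0 hB))
  unfold NMixChord
  linarith [hdef, hnn]

/-- **The `(D·Z)²`-chord along an edge whose open child has `Gc = 0`** from `A ≥ 0`, `B ≥ 0` and `Gc p⁰ ≥ 0`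
(g22's weakening). -/
theorem nMixChord_DZ2_of_bern (hp : IsProbVec p) (h1 : Gc (Function.update p e 1) ends o a₁ a₂ a₃ b = 0)
    (h0 : 0 ≤ Gc (Function.update p e 0) ends o a₁ a₂ a₃ b)
    (hA : 0 ≤ chordA p ends o a₁ a₂ a₃ b e) (hB : 0 ≤ chordB p ends o a₁ a₂ a₃ b e) :
    NMixChord (normDZ2 ends a₁ a₂ a₃) p ends o a₁ a₂ a₃ b e :=
  nMixChord_DZ2_of_DZ hp (nMixChord_DZ_of_bern hp h1 hA hB) h0

/-- If `(1 − q) A + q B ≥ 0` for every `q ∈ (0, 1)` then `A ≥ 0` (take `q` small). -/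
lemma nonneg_left_of_slopes {A B : R} (h : ∀ q : R, 0 < q → q < 1 → 0 ≤ (1 - q) * A + q * B) : 0 ≤ A := by
  by_contra hA
  push Not at hA
  have habs := abs_nonneg B
  have hcpos : 0 < |B| - A := by linarith
  set q : R := -A / (2 * (|B| - A)) with hq
  have hq0 : 0 < q := div_pos (by linarith) (by linarith)
  have hq1 : q < 1 := by
    have hlt : -A < 2 * (|B| - A) := by linarith
    rw [hq]
    exact (div_lt_one (by linarith)).2 hlt
  have hqc : q * (|B| - A) = -A / 2 := by
    rw [hq]
    field_simp
  have hB : q * B ≤ q * |B| := mul_le_mul_of_nonneg_left (le_abs_self B) hq0.le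
  have := h q hq0 hq1
  nlinarith [hB, hqc]

/-- If `(1 − q) A + q B ≥ 0` for every `q ∈ (0, 1)` then `B ≥ 0` (take `q` close to `1`). -/
lemma nonneg_right_of_slopes {A B : R} (h : ∀ q : R, 0 < q → q < 1 → 0 ≤ (1 - q) * A + q * B) : 0 ≤ B := by
  refine nonneg_left_of_slopes (A := B) (B := A) fun q hq0 hq1 => ?_
  have := h (1 - q) (by linarith) (by linarith)
  linarith

omit [LinearOrder R] [IsStrictOrderedRing R] in
/-- `A` does not see the weight of `e`. -/
lemma chordA_update (q : R) :
    chordA (Function.update p e q) ends o a₁ a₂ a₃ b e = chordA p ends o a₁ a₂ a₃ b e := by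
  unfold chordA EdgeLine.B1
  simp only [Function.update_idem]

omit [LinearOrder R] [IsStrictOrderedRing R] in
/-- `B` does not see the weight of `e`. -/
lemma chordB_update (q : R) :
    chordB (Function.update p e q) ends o a₁ a₂ a₃ b e = chordB p ends o a₁ a₂ a₃ b e := by
  unfold chordB EdgeLine.B2
  simp only [Function.update_idem]

/-- **`A ≥ 0` and `B ≥ 0` are NECESSARY**: if the `D·Z`-chord holds along `e` at every weight of `e` (and
`Gc p¹ = 0`), both slopes are nonnegative — the chord row along `e` IS the pair `A ≥ 0 ∧ B ≥ 0`. -/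
theorem chordAB_nonneg_of_nMixChord_all (h1 : Gc (Function.update p e 1) ends o a₁ a₂ a₃ b = 0)
    (hall : ∀ q : R, 0 < q → q < 1 →
      NMixChord (normDZ ends a₁ a₂ a₃) (Function.update p e q) ends o a₁ a₂ a₃ b e) :
    0 ≤ chordA p ends o a₁ a₂ a₃ b e ∧ 0 ≤ chordB p ends o a₁ a₂ a₃ b e := by
  have hslopes : ∀ q : R, 0 < q → q < 1 →
      0 ≤ (1 - q) * chordA p ends o a₁ a₂ a₃ b e + q * chordB p ends o a₁ a₂ a₃ b e := by
    intro q hq0 hq1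
    have hm := hall q hq0 hq1
    unfold NMixChord at hm
    have h1' : Gc (Function.update (Function.update p e q) e 1) ends o a₁ a₂ a₃ b = 0 := by
      rw [Function.update_idem]
      exact h1
    have hdef := dzChord_deficit_eq (Function.update p e q) ends o a₁ a₂ a₃ b e h1'
    simp only [Function.update_idem, Function.update_self, chordA_update, chordB_update] at hdef
    have hpos : 0 < q * (1 - q) := mul_pos hq0 (by linarith)
    have hnn : 0 ≤ q * (1 - q) *
        ((1 - q) * chordA p ends o a₁ a₂ a₃ b e + q * chordB p ends o a₁ a₂ a₃ b e) := by
      rw [← hdef]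
      simp only [Function.update_idem, Function.update_self] at hm
      linarith
    exact (mul_nonneg_iff_of_pos_left hpos).1 hnn
  exact ⟨nonneg_left_of_slopes hslopes, nonneg_right_of_slopes hslopes⟩

end Chord

section OClass

variable {V : Type*} {E : Type*} [Fintype E] [DecidableEq E] {R : Type*} [Field R]
  [LinearOrder R] [IsStrictOrderedRing R]

variable {p : E → R} {ends : E → Sym2 V} {o a₁ a₂ a₃ b : V} {e : E}

/-- **The `o`-class `D·Z`-chord from `A ≥ 0` and `B ≥ 0`.** -/
theorem nMixChord_DZ_of_oClass_bern (hp : IsProbVec p) (hO : OClass p ends o a₁ a₂ e)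
    (hA : 0 ≤ chordA p ends o a₁ a₂ a₃ b e) (hB : 0 ≤ chordB p ends o a₁ a₂ a₃ b e) :
    NMixChord (normDZ ends a₁ a₂ a₃) p ends o a₁ a₂ a₃ b e :=
  nMixChord_DZ_of_bern hp (ParallelEdge.Gc_update_one_eq_zero_of_oClass hO a₃ b) hA hB

/-- **The `o`-class `(D·Z)²`-chord (the chain's row) from `A ≥ 0`, `B ≥ 0` and `Gc p⁰ ≥ 0`.** -/
theorem nMixChord_DZ2_of_oClass_bern (hp : IsProbVec p) (hO : OClass p ends o a₁ a₂ e)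
    (h0 : 0 ≤ Gc (Function.update p e 0) ends o a₁ a₂ a₃ b)
    (hA : 0 ≤ chordA p ends o a₁ a₂ a₃ b e) (hB : 0 ≤ chordB p ends o a₁ a₂ a₃ b e) :
    NMixChord (normDZ2 ends a₁ a₂ a₃) p ends o a₁ a₂ a₃ b e :=
  nMixChord_DZ2_of_bern hp (ParallelEdge.Gc_update_one_eq_zero_of_oClass hO a₃ b) h0 hA hB

end OClass

end Mix

end Summit.Ventures.PercRepro2
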